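import Mathlib.FieldTheory.IsAlgClosed.Classification
import Mathlib.FieldTheory.IsAlgClosed.AlgebraicClosure
import Mathlib.RingTheory.Localization.Cardinality
import Mathlib.RingTheory.Algebraic.Cardinality
import Mathlib.Analysis.Complex.Cardinality
import Mathlib.Analysis.Complex.Polynomial.Basic
import Literature.AlgebraicGeometry.Motives.CrystallineRealization

/-!
# `GrothendieckExistenceDescent` (stmt-HodgeConjecture-1814) · the embedding `τ : K = W(k)[1/p] ↪ ℂ` exists

Clause (b) of the informal support item P3 of route `HodgeConjecture/PadicSemiregularLift` begins
"choose `τ : K ↪ ℂ` (`ℂ` algebraically closed of transcendence degree `2^ℵ₀ ≥ |K|`)". The typed P3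
theorems of `Theorems/PadicSemiregularLiftGrothendieckExistenceDescent.lean` hold for EVERY
`τ : K(p, k) →+* ℂ`; this file records that such a `τ` EXISTS whenever the perfect residue field `k`
has at most continuum many elements (e.g. `k = 𝔽̄_p`, the anchors of the route): `|W(k)| = |k|^ℵ₀ = 𝔠`
(`W(k)` is `k^ℕ` as a set), `|K| = |W(k)|` (fraction field), `|K̄| = 𝔠` (algebraic closure of an
infinite field), and two uncountable algebraically closed fields of characteristic `0` of the same
cardinality are isomorphic (Steinitz; Mathlib `IsAlgClosed.ringEquiv_of_equiv_of_charZero`), so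
`K ↪ K̄ ≅ ℂ`; and, in the form clause (b) actually uses ("extending the inclusion `k₁ ⊂ ℂ`" of the
field of definition), `exists_ringHom_complex_comp_eq` / `exists_ringHom_fractionRing_wittVector_comp_eq`:
for a COUNTABLE `k₁` with `i : k₁ →+* K`, `σ₀ : k₁ →+* ℂ` there is `τ : K →+* ℂ` with `τ ∘ i = σ₀`
(transcendence bases of `K̄` and `ℂ` over `k₁` are equipotent, and the induced `k₁`-isomorphism of
purely transcendental subfields extends to the algebraic closures).

References: E. Steinitz, *Algebraische Theorie der Körper* (1910) §§22–24 (classification);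
[Cassels1976] (embedding finitely generated fields in `p`-adic fields — the converse direction used
by the route to PRODUCE `k₁ ⊆ K`).
-/

-- `Summit.HodgeConjecture.HodgeConjecture.…` repeats the summit name by the D-0017 layout (Sub = Summit).
set_option linter.dupNamespace false

noncomputable section

open Cardinal
open scoped Isocrystal

namespace Summit.HodgeConjecture.HodgeConjecture.Theorems.GrothendieckExistenceDescent

universe u

/-- `W(k)` is `k^ℕ` as a set: `#W(k) = #k ^ ℵ₀` (the Witt vector `x` is its coefficient sequence
`n ↦ x.coeff n`). [folklore] -/
theorem cardinalMk_wittVector (p : ℕ) (k : Type u) [CommRing k] :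
    #(WittVector p k) = #k ^ ℵ₀ := by
  have e : WittVector p k ≃ (ℕ → k) :=
    ⟨fun x n => x.coeff n, fun f => WittVector.mk p f, fun x => by ext n; rfl, fun f => rfl⟩
  rw [Cardinal.mk_congr e, Cardinal.mk_arrow, Cardinal.mk_nat, Cardinal.lift_aleph0,
    Cardinal.lift_uzero]

/-- For a nontrivial ring `k` with at most continuum many elements, `#W(k) = 𝔠`
(`2^ℵ₀ ≤ #k^ℵ₀ ≤ 𝔠^ℵ₀ = 𝔠`). [folklore] -/
theorem cardinalMk_wittVector_eq_continuum (p : ℕ) (k : Type) [CommRing k] [Nontrivial k]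
    (hk : #k ≤ 𝔠) : #(WittVector p k) = 𝔠 := by
  rw [cardinalMk_wittVector]
  refine le_antisymm ((power_le_power_right hk).trans_eq continuum_power_aleph0) ?_
  calc 𝔠 = 2 ^ ℵ₀ := two_power_aleph0.symm
    _ ≤ #k ^ ℵ₀ := power_le_power_right (Cardinal.two_le_iff.mpr ⟨0, 1, zero_ne_one⟩)

/-- `#K = 𝔠` for `K = W(k)[1/p] = Frac W(k)`, `k` a field of characteristic `p` with `#k ≤ 𝔠`.
[folklore] -/
theorem cardinalMk_fractionRing_wittVector_eq_continuum (p : ℕ) [Fact p.Prime] (k : Type) [Field k]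
    [CharP k p] (hk : #k ≤ 𝔠) : #K(p, k) = 𝔠 :=
  (Cardinal.mk_fractionRing _).trans (cardinalMk_wittVector_eq_continuum p k hk)

/-- **An embedding `τ : K = W(k)[1/p] ↪ ℂ` exists** for every field `k` of characteristic `p` with at
most continuum many elements (in particular for `k = 𝔽̄_p` and for every countable perfect field):
`K` has cardinality `𝔠`, hence so does its algebraic closure `K̄`, and `K̄ ≅ ℂ` as uncountable
algebraically closed fields of characteristic `0` of equal cardinality (Steinitz 1910; Mathlib
`IsAlgClosed.ringEquiv_of_equiv_of_charZero`). This makes the `∀ τ` form of the typed P3 theorems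
non-vacuous at the route's anchors. [folklore] -/
theorem nonempty_ringHom_fractionRing_wittVector_complex (p : ℕ) [Fact p.Prime] (k : Type)
    [Field k] [CharP k p] (hk : #k ≤ 𝔠) : Nonempty (K(p, k) →+* ℂ) := by
  have hK : #K(p, k) = 𝔠 := cardinalMk_fractionRing_wittVector_eq_continuum p k hk
  set L := AlgebraicClosure K(p, k)
  haveI : CharZero L := charZero_of_injective_algebraMap (algebraMap K(p, k) L).injective
  have hL : #L = 𝔠 := by
    refine le_antisymm ?_ ?_
    · refine (Algebra.IsAlgebraic.cardinalMk_le_max K(p, k) L).trans ?_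
      rw [hK, max_eq_left aleph0_le_continuum]
    · rw [← hK]
      exact Cardinal.mk_le_of_injective (algebraMap K(p, k) L).injective
  have hLℂ : Nonempty (L ≃ ℂ) := Cardinal.eq.mp (hL.trans Cardinal.mk_complex.symm)
  obtain ⟨e⟩ := IsAlgClosed.ringEquiv_of_equiv_of_charZero (hL ▸ aleph0_lt_continuum) hLℂ
  exact ⟨e.toRingHom.comp (algebraMap K(p, k) L)⟩

/-! ## Extending a prescribed embedding of a countable field of definition -/

/-- **Extension of embeddings into `ℂ` (Steinitz).** Let `k₁` be a countable field, `K` a field of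
cardinality `𝔠` and `i : k₁ →+* K`, `σ₀ : k₁ →+* ℂ` ring homomorphisms. Then there is an embedding
`τ : K →+* ℂ` EXTENDING `σ₀` along `i` (`τ ∘ i = σ₀`): transcendence bases `s` of `K̄ ⊇ K` and `t` of
`ℂ` over the countable `k₁` both have cardinality `𝔠` (Mathlib
`IsAlgClosed.cardinal_eq_cardinal_transcendence_basis_of_aleph0_lt'`), a bijection `s ≃ t` gives a
`k₁`-isomorphism `k₁[s] ≅ k₁[t]`, which extends to the algebraic closures `K̄ ≅ ℂ`
(`IsAlgClosure.equivOfEquiv`, compatible with `k₁` by `equivOfEquiv_algebraMap`). This is the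
field-theoretic content of "choose `τ : K ↪ ℂ` extending the inclusion `k₁ ⊂ ℂ` of the field of
definition" in clause (b) of P3. [folklore] -/
theorem exists_ringHom_complex_comp_eq {k₁ K : Type} [Field k₁] [Field K] (i : k₁ →+* K)
    (σ₀ : k₁ →+* ℂ) (hk₁ : #k₁ ≤ ℵ₀) (hK : #K = 𝔠) : ∃ τ : K →+* ℂ, τ.comp i = σ₀ := by
  classical
  let L := AlgebraicClosure K
  have hL : #L = 𝔠 := by
    refine le_antisymm ?_ ?_
    · refine (Algebra.IsAlgebraic.cardinalMk_le_max K L).trans ?_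
      rw [hK, max_eq_left aleph0_le_continuum]
    · rw [← hK]
      exact Cardinal.mk_le_of_injective (algebraMap K L).injective
  letI : Algebra k₁ L := ((algebraMap K L).comp i).toAlgebra
  letI : Algebra k₁ ℂ := σ₀.toAlgebra
  haveI : FaithfulSMul k₁ L :=
    (faithfulSMul_iff_algebraMap_injective k₁ L).mpr (algebraMap k₁ L).injective
  haveI : FaithfulSMul k₁ ℂ :=
    (faithfulSMul_iff_algebraMap_injective k₁ ℂ).mpr (algebraMap k₁ ℂ).injective
  obtain ⟨s, hs⟩ := exists_isTranscendenceBasis k₁ L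
  obtain ⟨t, ht⟩ := exists_isTranscendenceBasis k₁ ℂ
  have hs' : #L = #s :=
    IsAlgClosed.cardinal_eq_cardinal_transcendence_basis_of_aleph0_lt' _ hs hk₁
      (hL ▸ aleph0_lt_continuum)
  have ht' : #ℂ = #t :=
    IsAlgClosed.cardinal_eq_cardinal_transcendence_basis_of_aleph0_lt' _ ht hk₁
      (Cardinal.mk_complex ▸ aleph0_lt_continuum)
  obtain ⟨e⟩ : Nonempty (s ≃ t) := Cardinal.eq.mp (by rw [← hs', ← ht', hL, Cardinal.mk_complex])
  letI := IsAlgClosed.isAlgClosure_of_transcendence_basis _ hs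
  letI := IsAlgClosed.isAlgClosure_of_transcendence_basis _ ht
  let e' : Algebra.adjoin k₁ (Set.range (Subtype.val : s → L)) ≃ₐ[k₁]
      Algebra.adjoin k₁ (Set.range (Subtype.val : t → ℂ)) :=
    hs.1.aevalEquiv.symm.trans ((MvPolynomial.renameEquiv k₁ e).trans ht.1.aevalEquiv)
  refine ⟨(IsAlgClosure.equivOfEquiv L ℂ e'.toRingEquiv).toRingHom.comp (algebraMap K L), ?_⟩
  ext x
  have hx : algebraMap K L (i x) =
      algebraMap (Algebra.adjoin k₁ (Set.range (Subtype.val : s → L))) L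
        (algebraMap k₁ _ x) := by
    rw [← IsScalarTower.algebraMap_apply]; rfl
  rw [RingHom.comp_apply, RingHom.comp_apply, RingEquiv.toRingHom_eq_coe, RingEquiv.coe_toRingHom,
    hx, IsAlgClosure.equivOfEquiv_algebraMap, AlgEquiv.coe_ringEquiv,
    AlgEquiv.commutes, ← IsScalarTower.algebraMap_apply]
  rfl

/-- **`τ : K = W(k)[1/p] ↪ ℂ` extending a prescribed embedding of the field of definition.** For
`k` of characteristic `p` with `#k ≤ 𝔠`, a countable field `k₁` (e.g. finitely generated over `ℚ`),
`i : k₁ →+* K(p, k)` (Cassels-type embedding of the field of definition into the `p`-adic field) and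
`σ₀ : k₁ →+* ℂ` (the given complex embedding), there is `τ : K(p, k) →+* ℂ` with `τ ∘ i = σ₀` — so the
complex variety `Y = X₀ ⊗_{k₁,σ₀} ℂ` is `(X₀ ⊗_{k₁,i} K) ⊗_{K,τ} ℂ`, as clause (b) of P3 requires.
[folklore] -/
theorem exists_ringHom_fractionRing_wittVector_comp_eq (p : ℕ) [Fact p.Prime] (k : Type) [Field k]
    [CharP k p] (hk : #k ≤ 𝔠) {k₁ : Type} [Field k₁] (hk₁ : #k₁ ≤ ℵ₀) (i : k₁ →+* K(p, k))
    (σ₀ : k₁ →+* ℂ) : ∃ τ : K(p, k) →+* ℂ, τ.comp i = σ₀ :=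
  exists_ringHom_complex_comp_eq i σ₀ hk₁ (cardinalMk_fractionRing_wittVector_eq_continuum p k hk)

end Summit.HodgeConjecture.HodgeConjecture.Theorems.GrothendieckExistenceDescent

end
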